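import Summits.ResolutionOfSingularities.ResolutionOfSingularities.Theorems.WeightedInvariantIota3SigmaGaloisDescent
import Literature.AlgebraicGeometry.Resolution.FlatLocalRegularAscent
import HarnessLib

/-!
# The Galois base change `A ⊗_k L` of a local `k`-algebra: local, flat, regular, formally smooth, `𝔪`-extension — when the
# residue algebra `κ_A ⊗_k L` is a field («(G1)» of the Galois route; door `HypersurfaceCentreConstruction`,
# stmt-ResolutionOfSingularities-19897; P3 rung (c11σ); hand res-L1-w43-stub-3)

Topic: `Summits/ResolutionOfSingularities/ResolutionOfSingularities/Theorems`. Helper for the door item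
`HypersurfaceCentreConstruction` (stmt-ResolutionOfSingularities-19897, route `WeightedInvariant`), line `local-engine` (L W4.3),
def-free.

**Setting.** `k` a field, `A` a LOCAL commutative `k`-algebra with residue field `κ = A ⧸ 𝔪_A`, `L/k` a finite field extension,
`B := A ⊗_k L` (an `A`-algebra, free of rank `[L:k]`).  HYPOTHESIS (H): `B ⧸ 𝔪_A B` is a field — equivalently `κ ⊗_k L` is a field
(`isField_quotient_iff`: `B ⧸ 𝔪_A B ≅ κ ⊗_k L` by Mathlib's `quotIdealMapEquivTensorQuot` + `cancelBaseChange`); for finite fields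
`κ = 𝔽_{p^m}`, `L = 𝔽_{p^n}`, `k = 𝔽_p` this is `gcd(m, n) = 1` (the arithmetic input, NOT proved here).

**What is proved** under (H): `B` is local (`isLocalRing_of_isField_quotient`: `B` is integral over `A`, so every maximal ideal lies
over `𝔪_A` and contains the maximal ideal `𝔪_A B`), `𝔪_A B = 𝔪_B` (`map_maximalIdeal_eq`), the structure map is local, `B` is
REGULAR when `A` is (`isRegularLocalRing` — Literature `IsRegularLocalRing.of_flat_of_map_maximalIdeal_eq`, flat + `𝔪`-extension),
`B` is formally smooth over `A` when `L/k` is separable (Mathlib: `FormallyEtale.of_isSeparable` + base change) and essentially of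
finite type (Mathlib instance), `dim B = dim A`.  With res-L1-w43-stub-3's `TraceDescent.exists_traceDatum` (p-TraceDescent) and
`SigmaGaloisDescent.jSigmaPtLocal_map_eq_of_galois` this gives **`jSigmaPtLocal_tensor_eq`**: for `L/k` finite GALOIS and (H),
(J-can) at `(A, f)` and at `(B, f ⊗ 1)` and (EX) at `(B, f ⊗ 1)` imply `jSigmaPtLocal (f ⊗ 1) m = (jSigmaPtLocal f m)·B`.

[OURS · L1 W4.3 · (o53-desc′) (G1)]  Replaces the role of NO printed item; NOT a statement of the manuscript
[claim: Hironaka2017, status: under-review]. AI work, weaker than expert review.  No named facts.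

## References

* H. Matsumura, *Commutative Ring Theory*, CUP 1986, Thm. 23.7. [Matsumura1987]
* A. Grothendieck, *EGA IV*, Publ. Math. IHÉS 20 (1964), 0_IV (19.7.1). [EGA0IV]
* H. Hironaka, *Characteristic polyhedra of singularities*, J. Math. Kyoto Univ. 7 (1967), §3. [Hironaka1967]
-/

noncomputable section

open IsLocalRing Literature.AlgebraicGeometry.Resolution
open Summit.ResolutionOfSingularities.ResolutionOfSingularities.Cruxes.HypersurfaceCentreConstruction.LocalEngine
open Summit.ResolutionOfSingularities.ResolutionOfSingularities.Cruxes.HypersurfaceCentreConstruction.LocalEngine.Iota3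
open scoped TensorProduct

set_option linter.dupNamespace false -- mandated namespace of this single-conjunct summit

namespace Summit.ResolutionOfSingularities.ResolutionOfSingularities.Theorems

namespace GaloisBaseChange

variable (k A L : Type) [Field k] [CommRing A] [IsLocalRing A] [Algebra k A] [Field L] [Algebra k L] [FiniteDimensional k L]

/-! ## §1 `B ⧸ 𝔪_A B ≅ κ_A ⊗_k L` -/

omit [FiniteDimensional k L] in
/-- The residue algebra of the base change: `(A ⊗_k L) ⧸ 𝔪_A (A ⊗_k L) ≃+* κ_A ⊗_k L`. [folklore] -/
theorem nonempty_ringEquiv_quotient_tensor :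
    Nonempty (((A ⊗[k] L) ⧸ (maximalIdeal A).map (algebraMap A (A ⊗[k] L))) ≃+* (ResidueField A ⊗[k] L)) := by
  refine ⟨((Algebra.TensorProduct.quotIdealMapEquivTensorQuot (A ⊗[k] L) (maximalIdeal A)).toRingEquiv.trans
    (Algebra.TensorProduct.comm A (A ⊗[k] L) (A ⧸ maximalIdeal A)).toRingEquiv).trans ?_⟩
  exact (Algebra.TensorProduct.cancelBaseChange k A (ResidueField A) (ResidueField A) L).toRingEquiv

omit [FiniteDimensional k L] in
/-- (H) in residue form: `B ⧸ 𝔪_A B` is a field iff `κ_A ⊗_k L` is. [folklore] -/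
theorem isField_quotient_iff :
    IsField ((A ⊗[k] L) ⧸ (maximalIdeal A).map (algebraMap A (A ⊗[k] L))) ↔ IsField (ResidueField A ⊗[k] L) := by
  obtain ⟨e⟩ := nonempty_ringEquiv_quotient_tensor k A L
  exact ⟨fun h => MulEquiv.isField h e.symm.toMulEquiv, fun h => MulEquiv.isField h e.toMulEquiv⟩

/-! ## §2 Locality, `𝔪`-extension, regularity -/

/-- Under (H) the base change `A ⊗_k L` is LOCAL with maximal ideal `𝔪_A (A ⊗_k L)`. [cite: Matsumura1987, Thm. 23.7] -/
theorem isLocalRing_of_isField_quotient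
    (hF : IsField ((A ⊗[k] L) ⧸ (maximalIdeal A).map (algebraMap A (A ⊗[k] L)))) : IsLocalRing (A ⊗[k] L) := by
  have hmax : ((maximalIdeal A).map (algebraMap A (A ⊗[k] L))).IsMaximal := Ideal.Quotient.maximal_of_isField _ hF
  refine IsLocalRing.of_unique_max_ideal ⟨_, hmax, fun 𝔫 h𝔫 => ?_⟩
  -- `𝔫 ∩ A` is maximal (integrality), hence `= 𝔪_A`, hence `𝔪_A B ≤ 𝔫`, hence equality
  haveI := h𝔫
  have hunder : (𝔫.under A).IsMaximal := Ideal.IsMaximal.under A 𝔫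
  have heq : 𝔫.under A = maximalIdeal A := IsLocalRing.eq_maximalIdeal hunder
  have hle : (maximalIdeal A).map (algebraMap A (A ⊗[k] L)) ≤ 𝔫 := by
    rw [Ideal.map_le_iff_le_comap, ← Ideal.under_def, heq]
  exact (hmax.eq_of_le h𝔫.ne_top hle).symm

/-- Under (H): `𝔪_A (A ⊗_k L) = 𝔪_{A ⊗_k L}`. [cite: Matsumura1987, Thm. 23.7] -/
theorem map_maximalIdeal_eq (hF : IsField ((A ⊗[k] L) ⧸ (maximalIdeal A).map (algebraMap A (A ⊗[k] L)))) :
    letI := isLocalRing_of_isField_quotient k A L hF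
    (maximalIdeal A).map (algebraMap A (A ⊗[k] L)) = maximalIdeal (A ⊗[k] L) := by
  letI := isLocalRing_of_isField_quotient k A L hF
  exact IsLocalRing.eq_maximalIdeal (Ideal.Quotient.maximal_of_isField _ hF)

/-- Under (H) the structure map is local. [folklore] -/
theorem isLocalHom (hF : IsField ((A ⊗[k] L) ⧸ (maximalIdeal A).map (algebraMap A (A ⊗[k] L)))) :
    letI := isLocalRing_of_isField_quotient k A L hF
    IsLocalHom (algebraMap A (A ⊗[k] L)) := by
  letI := isLocalRing_of_isField_quotient k A L hF
  exact isLocalHom_of_map_maximalIdeal_eq (map_maximalIdeal_eq k A L hF)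

omit [IsLocalRing A] [FiniteDimensional k L] in
/-- `L/k` separable ⇒ `A ⊗_k L` formally smooth over `A` (Mathlib: separable field extensions are formally étale; base change).
[cite: EGA0IV, 0_IV (19.7.1)] -/
theorem formallySmooth [Algebra.IsSeparable k L] : Algebra.FormallySmooth A (A ⊗[k] L) := by
  haveI : Algebra.FormallyEtale k L := Algebra.FormallyEtale.of_isSeparable k L
  infer_instance

end GaloisBaseChange

namespace GaloisBaseChange

/-! ## §2b Regularity -/

/-- Under (H), `A` regular ⇒ `A ⊗_k L` REGULAR local (flat with `𝔪`-extension). [cite: Matsumura1987, Thm. 23.7] -/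
theorem isRegularLocalRing (k A L : Type) [Field k] [CommRing A] [IsRegularLocalRing A] [Algebra k A] [Field L] [Algebra k L]
    [FiniteDimensional k L]
    (hF : IsField ((A ⊗[k] L) ⧸ (maximalIdeal A).map (algebraMap A (A ⊗[k] L)))) : IsRegularLocalRing (A ⊗[k] L) := by
  letI := isLocalRing_of_isField_quotient k A L hF
  haveI := isLocalHom k A L hF
  haveI : IsNoetherianRing (A ⊗[k] L) := IsNoetherianRing.of_finite A (A ⊗[k] L)
  exact IsRegularLocalRing.of_flat_of_map_maximalIdeal_eq A (A ⊗[k] L) (map_maximalIdeal_eq k A L hF)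


section Assembly

variable (k A L : Type) [Field k] [CommRing A] [IsLocalRing A] [Algebra k A] [Field L] [Algebra k L] [FiniteDimensional k L]

/-! ## §3 `jSigmaPtLocal` commutes with the Galois base change (GAP 2 shape), modulo (J-can) and (EX) -/

/-- **`jSigmaPtLocal` COMMUTES WITH `A → A ⊗_k L`** for `L/k` finite GALOIS under (H), given (J-can) at `(A, f)` and at
`(A ⊗_k L, f ⊗ 1)` and (EX) at `(A ⊗_k L, f ⊗ 1)` (SPEC (Δ12) texts), `f ∈ 𝔪_A ∖ 0`.  Assembly of p-TraceDescent (`exists_traceDatum`),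
p-SigmaGaloisDescent (`jSigmaPtLocal_map_eq_of_galois`) and §2. [cite: Hironaka1967, §3] [OURS · L1 W4.3 · (o53-desc′) (G1)+(G4)] -/
theorem jSigmaPtLocal_tensor_eq [IsGalois k L]
    (hF : IsField ((A ⊗[k] L) ⧸ (maximalIdeal A).map (algebraMap A (A ⊗[k] L)))) {f : A} (hf0 : f ≠ 0)
    (hf : f ∈ maximalIdeal A) :
    letI := isLocalRing_of_isField_quotient k A L hF
    (∀ (g₁ g₂ : A) (q r₁ r₂ : ℕ) (g₁' g₂' : A) (q' r₁' r₂' : ℕ),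
      IsSigmaMaximiser f (adicOrder f).toNat g₁ g₂ q r₁ r₂ → IsPrimitiveTriple q r₁ r₂ →
      IsSigmaMaximiser f (adicOrder f).toNat g₁' g₂' q' r₁' r₂' → IsPrimitiveTriple q' r₁' r₂' →
      ∀ m : ℕ, flagContactFiltration g₁' g₂' q' r₁' r₂' m = flagContactFiltration g₁ g₂ q r₁ r₂ m) →
    (∀ (g₁ g₂ : A ⊗[k] L) (q r₁ r₂ : ℕ) (g₁' g₂' : A ⊗[k] L) (q' r₁' r₂' : ℕ),
      IsSigmaMaximiser (algebraMap A (A ⊗[k] L) f) (adicOrder (algebraMap A (A ⊗[k] L) f)).toNat g₁ g₂ q r₁ r₂ →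
      IsPrimitiveTriple q r₁ r₂ →
      IsSigmaMaximiser (algebraMap A (A ⊗[k] L) f) (adicOrder (algebraMap A (A ⊗[k] L) f)).toNat g₁' g₂' q' r₁' r₂' →
      IsPrimitiveTriple q' r₁' r₂' →
      ∀ m : ℕ, flagContactFiltration g₁' g₂' q' r₁' r₂' m = flagContactFiltration g₁ g₂ q r₁ r₂ m) →
    (∃ (g₁ g₂ : A ⊗[k] L) (q r₁ r₂ : ℕ),
      IsSigmaMaximiser (algebraMap A (A ⊗[k] L) f) (adicOrder (algebraMap A (A ⊗[k] L) f)).toNat g₁ g₂ q r₁ r₂ ∧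
        IsPrimitiveTriple q r₁ r₂) →
    ∀ m : ℕ, jSigmaPtLocal (algebraMap A (A ⊗[k] L) f) m = (jSigmaPtLocal f m).map (algebraMap A (A ⊗[k] L)) := by
  letI := isLocalRing_of_isField_quotient k A L hF
  intro hcanA hcanB hexB m
  classical
  obtain ⟨t, ι, _, b, c, ht, hdual⟩ := TraceDescent.exists_traceDatum k A L
  -- the automorphisms `id ⊗ g`, `g ∈ Gal(L/k)`, as `A`-algebra automorphisms of `A ⊗_k L`
  refine SigmaGaloisDescent.jSigmaPtLocal_map_eq_of_galois (map_maximalIdeal_eq k A L hF)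
    (fun g : L ≃ₐ[k] L => Algebra.TensorProduct.congr (AlgEquiv.refl : A ≃ₐ[A] A) g) t (fun y => ?_) b c
    (fun x => hdual x) hf0 hf hcanA hcanB hexB m
  rw [ht y]
  rfl

end Assembly

/-! ## §4 The arithmetic input: (H) for coprime degrees; the finite-field case `A ⊗_{𝔽_p} 𝔽_{p^n}` -/

section Coprime

open Module

/-- **Finite extensions of coprime degree have a FIELD tensor product**: `[K:F]`, `[L:F]` coprime ⇒ `K ⊗_F L` is a field
(Mathlib: embed both in `F̄`; coprime degrees ⇒ linearly disjoint images ⇒ the tensor product of algebraic extensions is a field).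
[folklore] -/
theorem isField_tensor_of_coprime (F K L : Type*) [Field F] [Field K] [Field L] [Algebra F K] [Algebra F L]
    [FiniteDimensional F K] [FiniteDimensional F L] (h : (finrank F K).Coprime (finrank F L)) : IsField (K ⊗[F] L) := by
  let E := AlgebraicClosure F
  have halgK : Algebra.IsAlgebraic F K := Algebra.IsAlgebraic.of_finite F K
  have halgL : Algebra.IsAlgebraic F L := Algebra.IsAlgebraic.of_finite F L
  let fa : K →ₐ[F] E := IsAlgClosed.lift
  let fb : L →ₐ[F] E := IsAlgClosed.lift
  refine IntermediateField.LinearDisjoint.isField_of_isAlgebraic' (E := E) (fa := fa) (fb := fb) ?_ (Or.inl halgK)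
  refine IntermediateField.LinearDisjoint.of_finrank_coprime ?_
  have e1 : finrank F fa.fieldRange = finrank F K := (AlgEquiv.ofInjectiveField fa).toLinearEquiv.finrank_eq.symm
  have e2 : finrank F fb.fieldRange = finrank F L := (AlgEquiv.ofInjectiveField fb).toLinearEquiv.finrank_eq.symm
  rw [e1, e2]; exact h

/-- **`κ ⊗_{𝔽_p} 𝔽_{p^n}` is a field for `gcd([κ:𝔽_p], n) = 1`** (`κ` a finite field of characteristic `p`, `0 < n`). [folklore] -/
theorem isField_tensor_galoisField (p : ℕ) [Fact p.Prime] (κ : Type*) [Field κ] [Algebra (ZMod p) κ] [Finite κ]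
    (n : ℕ) (hn : n ≠ 0) (h : (finrank (ZMod p) κ).Coprime n) : IsField (κ ⊗[ZMod p] GaloisField p n) := by
  haveI : FiniteDimensional (ZMod p) κ := inferInstance
  refine isField_tensor_of_coprime (ZMod p) κ (GaloisField p n) ?_
  rwa [GaloisField.finrank p hn]

/-- **(H) for the cyclic Galois base change `A ⊗_{𝔽_p} 𝔽_{p^n}`**: `A` local of characteristic `p` with FINITE residue field `κ`,
`gcd([κ:𝔽_p], n) = 1`, `0 < n` ⇒ `(A ⊗_{𝔽_p} 𝔽_{p^n}) ⧸ 𝔪_A(…)` is a field — so §2–§3 apply: `A ⊗_{𝔽_p} 𝔽_{p^n}` is local (regular if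
`A` is), flat, formally smooth, `𝔪`-extension, with the Frobenius/Galois trace datum, and `jSigmaPtLocal` commutes with
`A → A ⊗_{𝔽_p} 𝔽_{p^n}` modulo (J-can), (EX). [folklore] -/
theorem isField_quotient_galoisField (p : ℕ) [Fact p.Prime] (A : Type) [CommRing A] [IsLocalRing A] [Algebra (ZMod p) A]
    [Finite (ResidueField A)] (n : ℕ) (hn : n ≠ 0) (h : (finrank (ZMod p) (ResidueField A)).Coprime n) :
    IsField ((A ⊗[ZMod p] GaloisField p n) ⧸ (maximalIdeal A).map (algebraMap A (A ⊗[ZMod p] GaloisField p n))) :=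
  (isField_quotient_iff (ZMod p) A (GaloisField p n)).mpr (isField_tensor_galoisField p (ResidueField A) n hn h)

/-- The packaged finite-field statement: `jSigmaPtLocal` commutes with `A → A ⊗_{𝔽_p} 𝔽_{p^n}` (`A` local of characteristic `p`,
finite residue field of degree prime to `n`), MODULO (J-can) at both ends and (EX) upstairs. [cite: Hironaka1967, §3]
[OURS · L1 W4.3 · (o53-desc′) (G1)+(G4), finite residue field] -/
theorem jSigmaPtLocal_galoisField_eq (p : ℕ) [Fact p.Prime] (A : Type) [CommRing A] [IsLocalRing A] [Algebra (ZMod p) A]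
    [Finite (ResidueField A)] (n : ℕ) (hn : n ≠ 0) (h : (finrank (ZMod p) (ResidueField A)).Coprime n) {f : A} (hf0 : f ≠ 0)
    (hf : f ∈ maximalIdeal A) :
    letI := isLocalRing_of_isField_quotient (ZMod p) A (GaloisField p n) (isField_quotient_galoisField p A n hn h)
    (∀ (g₁ g₂ : A) (q r₁ r₂ : ℕ) (g₁' g₂' : A) (q' r₁' r₂' : ℕ),
      IsSigmaMaximiser f (adicOrder f).toNat g₁ g₂ q r₁ r₂ → IsPrimitiveTriple q r₁ r₂ →
      IsSigmaMaximiser f (adicOrder f).toNat g₁' g₂' q' r₁' r₂' → IsPrimitiveTriple q' r₁' r₂' →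
      ∀ m : ℕ, flagContactFiltration g₁' g₂' q' r₁' r₂' m = flagContactFiltration g₁ g₂ q r₁ r₂ m) →
    (∀ (g₁ g₂ : A ⊗[ZMod p] GaloisField p n) (q r₁ r₂ : ℕ) (g₁' g₂' : A ⊗[ZMod p] GaloisField p n) (q' r₁' r₂' : ℕ),
      IsSigmaMaximiser (algebraMap A _ f) (adicOrder (algebraMap A (A ⊗[ZMod p] GaloisField p n) f)).toNat g₁ g₂ q r₁ r₂ →
      IsPrimitiveTriple q r₁ r₂ →
      IsSigmaMaximiser (algebraMap A _ f) (adicOrder (algebraMap A (A ⊗[ZMod p] GaloisField p n) f)).toNat g₁' g₂' q' r₁' r₂' →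
      IsPrimitiveTriple q' r₁' r₂' →
      ∀ m : ℕ, flagContactFiltration g₁' g₂' q' r₁' r₂' m = flagContactFiltration g₁ g₂ q r₁ r₂ m) →
    (∃ (g₁ g₂ : A ⊗[ZMod p] GaloisField p n) (q r₁ r₂ : ℕ),
      IsSigmaMaximiser (algebraMap A _ f) (adicOrder (algebraMap A (A ⊗[ZMod p] GaloisField p n) f)).toNat g₁ g₂ q r₁ r₂ ∧
        IsPrimitiveTriple q r₁ r₂) →
    ∀ m : ℕ, jSigmaPtLocal (algebraMap A (A ⊗[ZMod p] GaloisField p n) f) m =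
      (jSigmaPtLocal f m).map (algebraMap A (A ⊗[ZMod p] GaloisField p n)) :=
  jSigmaPtLocal_tensor_eq (ZMod p) A (GaloisField p n) (isField_quotient_galoisField p A n hn h) hf0 hf

/-- **`jSigmaPtLocal` commutes with `A → A ⊗_{𝔽_p} 𝔽_{p^n}`** (`A` local of characteristic `p`, finite residue field `κ`,
`gcd([κ:𝔽_p], n) = 1`, `f ∈ 𝔪_A ∖ 0`) MODULO (J-can) and (EX) at `(A ⊗ 𝔽_{p^n}, f ⊗ 1)` ONLY (they descend to `A`).
[cite: Hironaka1967, §3] [OURS · L1 W4.3 · (o53-desc′) (G4′), finite residue field] -/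
theorem jSigmaPtLocal_galoisField_eq' (p : ℕ) [Fact p.Prime] (A : Type) [CommRing A] [IsLocalRing A] [Algebra (ZMod p) A]
    [Finite (ResidueField A)] (n : ℕ) (hn : n ≠ 0) (h : (finrank (ZMod p) (ResidueField A)).Coprime n) {f : A} (hf0 : f ≠ 0)
    (hf : f ∈ maximalIdeal A) :
    letI := isLocalRing_of_isField_quotient (ZMod p) A (GaloisField p n) (isField_quotient_galoisField p A n hn h)
    (∀ (g₁ g₂ : A ⊗[ZMod p] GaloisField p n) (q r₁ r₂ : ℕ) (g₁' g₂' : A ⊗[ZMod p] GaloisField p n) (q' r₁' r₂' : ℕ),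
      IsSigmaMaximiser (algebraMap A _ f) (adicOrder (algebraMap A (A ⊗[ZMod p] GaloisField p n) f)).toNat g₁ g₂ q r₁ r₂ →
      IsPrimitiveTriple q r₁ r₂ →
      IsSigmaMaximiser (algebraMap A _ f) (adicOrder (algebraMap A (A ⊗[ZMod p] GaloisField p n) f)).toNat g₁' g₂' q' r₁' r₂' →
      IsPrimitiveTriple q' r₁' r₂' →
      ∀ m : ℕ, flagContactFiltration g₁' g₂' q' r₁' r₂' m = flagContactFiltration g₁ g₂ q r₁ r₂ m) →
    (∃ (g₁ g₂ : A ⊗[ZMod p] GaloisField p n) (q r₁ r₂ : ℕ),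
      IsSigmaMaximiser (algebraMap A _ f) (adicOrder (algebraMap A (A ⊗[ZMod p] GaloisField p n) f)).toNat g₁ g₂ q r₁ r₂ ∧
        IsPrimitiveTriple q r₁ r₂) →
    ∀ m : ℕ, jSigmaPtLocal (algebraMap A (A ⊗[ZMod p] GaloisField p n) f) m =
      (jSigmaPtLocal f m).map (algebraMap A (A ⊗[ZMod p] GaloisField p n)) := by
  letI := isLocalRing_of_isField_quotient (ZMod p) A (GaloisField p n) (isField_quotient_galoisField p A n hn h)
  intro hcanB hexB m
  classical
  obtain ⟨t, ι, _, b, c, ht, hdual⟩ := TraceDescent.exists_traceDatum (ZMod p) A (GaloisField p n)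
  refine SigmaGaloisDescent.jSigmaPtLocal_map_eq_of_galois'
    (map_maximalIdeal_eq (ZMod p) A (GaloisField p n) (isField_quotient_galoisField p A n hn h))
    (fun g : GaloisField p n ≃ₐ[ZMod p] GaloisField p n => Algebra.TensorProduct.congr (AlgEquiv.refl : A ≃ₐ[A] A) g) t
    (fun y => ?_) b c (fun x => hdual x) hf0 hf hcanB hexB m
  rw [ht y]
  rfl

end Coprime

end GaloisBaseChange

end Summit.ResolutionOfSingularities.ResolutionOfSingularities.Theorems

end
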